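import Summits.AnomalousDissipation.AnomalousDissipation.Theorems.QuasiStaticSolenoidalCellTensorQ.Negative.NominalLawFailsAtDesignWord
import HarnessLib

/-!
# Negative side of K2Q `QuasiStaticSolenoidalCellTensorQ` (stmt-AnomalousDissipation-19072): reduction of `¬ K2Q` to the
# general-word energy floor (helper, `--supports stmt-AnomalousDissipation-19072`)

Summits-side helper file (everything proved; no definitions, no named facts).  `not_quasiStatic_of_floorAll`: IF every
isotropic lattice word (`IsotropicWordGain W c₀`, `c₀ > 0`) admits, for every precision `δ > 0` and every cell viscosity
`ν > 0`, from some cell number `n₀` on and with some transient constant `C > 0`, on every horizon `T` a weak `A = 0`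
passive-vector solution around its replayed `1/n`-cells from the gravest single mode whose energy stays above
`C·exp(−8π²(1 + (1+δ)(1−4ρ/3)c₀/ν²)(ν/n²)t)·‖w₀‖²` (the REALISED-constant floor; its Galerkin core is
`…Negative.GalerkinFloor.galerkin_floor_cell`), THEN the route's K2Q `QuasiStaticSolenoidalCellTensorQ` is false: at
`c = (1 − 2ρ/3)c₀ < c₀` the nominal ceiling `(K/ν)e^{−8π²(1+c/ν²)(ν/n²)t}` undercuts the floor taken at
`(1+δ)(1−4ρ/3) = 1−ρ` after a finite crossing time (`le_crossing_time`), on every horizon.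
This is NOT a proof of anomalous dissipation; it isolates the remaining analytic input of `¬ K2Q`.
-/

set_option linter.dupNamespace false

noncomputable section

namespace Summit.AnomalousDissipation.AnomalousDissipation.Theorems.QuasiStaticSolenoidalCellTensorQ.Negative

open Set MeasureTheory Filter
open scoped InnerProductSpace
open Literature.Analysis Literature.Analysis.FunctionSpaces Literature.Analysis.FunctionSpaces.Torus
open Literature.Analysis.FluidPDE Literature.Analysis.FluidPDE.LatticeShear
open Summit.AnomalousDissipation.AnomalousDissipation.Theorems.SolenoidalFractalHomogenisation.RealisedQuasiStaticCellLaw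

set_option maxHeartbeats 800000 in
/-- **`¬ K2Q` from the general-word realised floor.** See the module docstring. -/
theorem not_quasiStatic_of_floorAll
    (hfloor : ∀ k (W : LatticeWord k) (c₀ : ℝ), 0 < c₀ → IsotropicWordGain W c₀ → ∀ δ > (0:ℝ), ∀ ν, ∀ hν : 0 < ν,
      ∃ n₀ : ℕ, ∃ C > (0:ℝ), ∀ n : ℕ, n₀ ≤ n → ∀ T > (0:ℝ),
        ∃ w, Torus.IsWeakPassiveVectorOn 0 T (ν / (n:ℝ) ^ 2) ((W.stretch (1 / ν) (one_div_pos.mpr hν)).cell n)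
            (fun x => (UnitAddTorus.mFourier (Pi.single 0 1 : Fin 3 → ℤ) x).re •
              (EuclideanSpace.single 1 (1:ℝ) : EuclideanSpace ℝ (Fin 3))) w ∧
          ∀ᵐ t ∂(volume.restrict (Ioo 0 T)),
            C * Real.exp (-(8 * Real.pi ^ 2 * (1 + (1 + δ) * ((1 - 4 * W.ramp / 3) * c₀) / ν ^ 2) * ν / (n:ℝ) ^ 2) * t) *
                ∫ x, ‖(UnitAddTorus.mFourier (Pi.single 0 1 : Fin 3 → ℤ) x).re •
                  (EuclideanSpace.single 1 (1:ℝ) : EuclideanSpace ℝ (Fin 3))‖ ^ 2 ≤ ∫ x, ‖w t x‖ ^ 2) :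
    ¬ Summit.AnomalousDissipation.AnomalousDissipation.Theses.SolenoidalFractalHomogenisation.QuasiStaticSolenoidalCellTensorQ := by
  rintro ⟨k, W, c₀, hc₀, hW, H⟩
  have hρ0 : 0 < W.ramp := W.ramp_pos
  have hρ1 : W.ramp ≤ 1 / 2 := W.ramp_le
  have h43 : 0 < 1 - 4 * W.ramp / 3 := by linarith
  -- the gain `c = (1 - 2ρ/3)c₀ < c₀` and the precision `δ` with `(1+δ)(1-4ρ/3) = 1-ρ`
  obtain ⟨ν₂, hν₂, K₂, hK₂, G⟩ := H ((1 - 2 * W.ramp / 3) * c₀) (by nlinarith) (by nlinarith)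
  set δ : ℝ := (W.ramp / 3) / (1 - 4 * W.ramp / 3) with hδ
  have hδ0 : 0 < δ := by positivity
  have hδm : δ * (1 - 4 * W.ramp / 3) = W.ramp / 3 := by rw [hδ]; exact div_mul_cancel₀ _ h43.ne'
  have hδe : (1 + δ) * (1 - 4 * W.ramp / 3) = 1 - W.ramp := by rw [add_mul, one_mul, hδm]; ring
  -- a cell viscosity inside the regime and the floor data
  set ν : ℝ := ν₂ / 2 with hνdef
  have hν0 : 0 < ν := by positivity
  have hνlt : ν < ν₂ := by rw [hνdef]; linarith
  obtain ⟨n₀, C, hC, F⟩ := hfloor k W c₀ hc₀ hW δ hδ0 ν hν0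
  have G1 := G ν ⟨hν0, hνlt⟩
  rw [Real.rpow_one] at G1
  -- the gravest mode
  have hℓ : (Pi.single 0 1 : Fin 3 → ℤ) ≠ 0 := by
    intro h
    have h0 := congrFun h 0
    simp at h0
  have hp : ‖(EuclideanSpace.single 1 (1:ℝ) : EuclideanSpace ℝ (Fin 3))‖ = 1 := by simp
  have hpl : ⟪(EuclideanSpace.single 1 (1:ℝ) : EuclideanSpace ℝ (Fin 3)), latticeVec (Pi.single 0 1 : Fin 3 → ℤ)⟫_ℝ = 0 := by
    rw [latticeVec_single, EuclideanSpace.inner_single_left]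
    simp
  -- enough cells
  set n : ℕ := ⌈K₂ / ν⌉₊ + n₀ with hndef
  have hnG : ⌈K₂ / ν⌉₊ ≤ n := Nat.le_add_right _ _
  have hnF : n₀ ≤ n := Nat.le_add_left _ _
  have hK₂c : (0:ℝ) < (⌈K₂ / ν⌉₊ : ℕ) := by exact_mod_cast Nat.ceil_pos.mpr (div_pos hK₂ hν0)
  have hn0 : (0:ℝ) < n := by
    have : (n : ℝ) = (⌈K₂ / ν⌉₊ : ℕ) + (n₀ : ℕ) := by rw [hndef]; push_cast; ring
    rw [this]; positivity
  -- the exponents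
  set a : ℝ := 8 * Real.pi ^ 2 * (1 + (1 + δ) * ((1 - 4 * W.ramp / 3) * c₀) / ν ^ 2) * ν / (n:ℝ) ^ 2 with hadef
  set b : ℝ := 8 * Real.pi ^ 2 * (1 + (1 - 2 * W.ramp / 3) * c₀ / ν ^ 2) * ν / (n:ℝ) ^ 2 with hbdef
  have hab : a < b := by
    have e1 : (1 + δ) * ((1 - 4 * W.ramp / 3) * c₀) = (1 - W.ramp) * c₀ := by rw [← mul_assoc, hδe]
    have key : b - a = 8 * Real.pi ^ 2 * (W.ramp / 3 * c₀) / (ν * (n:ℝ) ^ 2) := by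
      rw [hadef, hbdef, e1]
      field_simp
      ring
    have hpos : 0 < 8 * Real.pi ^ 2 * (W.ramp / 3 * c₀) / (ν * (n:ℝ) ^ 2) := by positivity
    linarith
  set t₀ : ℝ := Real.log ((K₂ / ν) / C) / (b - a) with ht₀def
  set T : ℝ := |t₀| + 2 with hTdef
  have hT : 0 < T := by positivity
  obtain ⟨w, hw, hlow⟩ := F n hnF T hT
  have hup := G1 n hnG (fun x => (UnitAddTorus.mFourier (Pi.single 0 1 : Fin 3 → ℤ) x).re •
      (EuclideanSpace.single 1 (1:ℝ) : EuclideanSpace ℝ (Fin 3)))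
    (memSobolev_one_singleMode _ _) (isWeaklyDivFree_singleMode _ hpl) (hasZeroMean_singleMode hℓ _) T hT w hw
  -- both bounds hold at some late time
  have hsub : Ioo (|t₀| + 1) T ⊆ Ioo 0 T := Ioo_subset_Ioo_left (by positivity)
  have hmem : ∀ᵐ t ∂(volume.restrict (Ioo (|t₀| + 1) T)), t ∈ Ioo (|t₀| + 1) T := ae_restrict_mem measurableSet_Ioo
  haveI : (ae (volume.restrict (Ioo (|t₀| + 1) T))).NeBot := by
    rw [ae_neBot, Ne, Measure.restrict_eq_zero, Real.volume_Ioo, ENNReal.ofReal_eq_zero, not_le, hTdef]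
    linarith
  obtain ⟨t, ht, h1, h2⟩ := (hmem.and ((ae_restrict_of_ae_restrict_of_subset hsub hlow).and
    (ae_restrict_of_ae_restrict_of_subset hsub hup))).exists
  have hE0 : 0 < ∫ x, ‖(UnitAddTorus.mFourier (Pi.single 0 1 : Fin 3 → ℤ) x).re •
      (EuclideanSpace.single 1 (1:ℝ) : EuclideanSpace ℝ (Fin 3))‖ ^ 2 := by
    rw [integral_norm_sq_singleMode_eq hℓ, hp]; norm_num
  have hcross : t ≤ t₀ := le_crossing_time hC hE0 hab (h1.trans h2)
  have habs : t₀ ≤ |t₀| := le_abs_self t₀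
  linarith [ht.1]

end Summit.AnomalousDissipation.AnomalousDissipation.Theorems.QuasiStaticSolenoidalCellTensorQ.Negative

end
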